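import Summits.QuantumFields.YangMills.Theses.FradkinShenkerFlow
import Literature.MathematicalPhysics.QuantumFieldTheory.LatticeGaugeProofs

/-!
# Stub `stub_haarResample_le_heatBath` of the line `orbit-slice-reduction` (crux `SusceptibilityToPoincare`)

Route `FradkinShenkerFlow` of `YangMills`, crux item `stmt-QuantumFields-9441`
(`Summit.QuantumFields.YangMills.Theses.FradkinShenkerFlow.SusceptibilityToPoincare`, FS ⇒ UP).
This file proves stub (2c) of the transfer `UP_inv ⇒ UP` of the registered skeleton
`Cruxes/SusceptibilityToPoincare/Lines/orbit-slice-reduction.lean`: **Haar resampling of a link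
is dominated by heat-bath resampling, and double counting**. For the 4D torus of side `2S+1`,
the Wilson measure `μ = wilsonMeasure r.ρ β`, the Haar probability measure of the compact gauge
group `G` and a bounded measurable `F`, there is `C = C(G, r, β)` (here
`C = 2 exp (|β| K)`, `K = 2 · 5 · 6 · (N + sup |Re tr ρ|)`) such that for every `S` and `F`

  `Σ_x Σ_{ℓ incident to x} ∫∫ (F U − F(U[ℓ ↦ h]))² dHaar(h) dμ(U)
      ≤ C Σ_ℓ ∫∫ (F U − F(U[ℓ ↦ g]))² dν_ℓ^U(g) dμ(U)`,

where `ν_ℓ^U = Haar.tilted (−β S_W(U[ℓ ↦ ·]))` is the one-link heat-bath law.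

## Proof

* *Double counting* (`HaarResample.sum_ite_le_two_mul`): a link `ℓ` is incident
  (`ℓ.1 = x ∨ ℓ.1.shift ℓ.2 = x`) to at most the two sites `ℓ.1`, `ℓ.1.shift ℓ.2`, and the
  summands are nonnegative, so after `Finset.sum_comm` the left side is at most
  `2 Σ_ℓ ∫∫ (…)² dHaar dμ`.
* *Oscillation of the tilt* (`HaarResample.abs_wilsonAction_update_sub_le`): two configurations
  that differ only on the link `ℓ` have the same bulk action off the shadow of `{ℓ}`
  (`bulkAction_congr`), and the shadow part is bounded by `5 · 6 · (N + sup |Re tr ρ|)`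
  (`abs_shadowAction_le`, `card_edgeShadow_le`), uniformly in the volume; hence the tilt
  `h ↦ −β S_W(U[ℓ ↦ h])` oscillates by at most `c = |β| K`.
* *Domination* (`HaarResample.integral_le_exp_mul_integral_tilted`): for a probability measure
  `κ` and a tilt `f` oscillating by at most `c`, the density of `κ.tilted f` is `≥ e^{−c}`
  (`integral_tilted`, `Z ≤ e^{f(h) + c}`), so `∫ ψ dκ ≤ e^{c} ∫ ψ d(κ.tilted f)` for bounded
  measurable `ψ ≥ 0`.
* *Integration in `U`* (`HaarResample.integral_haar_le_exp_mul_integral_heatBath`): the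
  heat-bath integral is measurable in `U` (parametric Bochner integral of the jointly measurable
  `(U, g) ↦ (e^{f_U(g)} / Z_U) (F U − F(U[ℓ ↦ g]))²`, `HaarResample.measurable_integral_tilted`)
  and bounded by `(2M)²` (`isProbabilityMeasure_tilted`), hence integrable against the
  probability measure `μ`, and `integral_mono_of_nonneg` applies. Second countability of `G`
  (needed for the measurability of the Wilson action) comes from the faithful representation `r`.
-/

noncomputable section

open MeasureTheory ProbabilityTheory
open Literature.MathematicalPhysics.QuantumFieldTheory

namespace Summit.QuantumFields.YangMills.Theorems.SusceptibilityToPoincare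

namespace HaarResample

/-! ### Abstract probability: tilted measures with a tilt of bounded oscillation -/

section Abstract

variable {Ω K : Type*} [MeasurableSpace Ω] [MeasurableSpace K]

/-- **Double counting**: if a decidable predicate `p` on a finite type holds at most at the two
points `a`, `b`, then `Σ_x [p x] t ≤ 2 t` for `t ≥ 0`. [folklore] -/
theorem sum_ite_le_two_mul {ι : Type*} [Fintype ι] (p : ι → Prop) [DecidablePred p] (a b : ι)
    (hp : ∀ x, p x → x = a ∨ x = b) {t : ℝ} (ht : 0 ≤ t) :
    ∑ x, (if p x then t else 0) ≤ 2 * t := by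
  classical
  rw [← Finset.sum_filter, Finset.sum_const, nsmul_eq_mul]
  have hsub : Finset.univ.filter p ⊆ ({a, b} : Finset ι) := fun x hx => by
    rw [Finset.mem_insert, Finset.mem_singleton]
    exact hp x (Finset.mem_filter.1 hx).2
  have hcard : ((Finset.univ.filter p).card : ℝ) ≤ 2 := by
    have h := (Finset.card_le_card hsub).trans Finset.card_le_two
    exact_mod_cast h
  exact mul_le_mul_of_nonneg_right hcard ht

/-- **Lower bound on the density of a tilted probability measure**: if the tilt `f` satisfies
`f h' ≤ f h + c` for all `h, h'` and `e^{f}` is integrable, then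
`e^{-c} ≤ e^{f h} / ∫ e^{f} dκ` for every `h` (since `∫ e^{f} dκ ≤ e^{f h + c}`). [folklore] -/
theorem exp_neg_le_exp_div_integral {κ : Measure K} [IsProbabilityMeasure κ] {f : K → ℝ}
    {c : ℝ} (hfi : Integrable (fun h => Real.exp (f h)) κ) (hosc : ∀ h h', f h' ≤ f h + c)
    (h : K) : Real.exp (-c) ≤ Real.exp (f h) / ∫ h', Real.exp (f h') ∂κ := by
  have hZpos : 0 < ∫ h', Real.exp (f h') ∂κ := integral_exp_pos hfi
  have hZle : ∫ h', Real.exp (f h') ∂κ ≤ Real.exp (f h + c) := by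
    have hmono := integral_mono hfi (integrable_const (Real.exp (f h + c)))
      fun h' => Real.exp_le_exp.2 (hosc h h')
    simpa only [integral_const, probReal_univ, one_smul] using hmono
  rw [le_div_iff₀ hZpos]
  calc Real.exp (-c) * ∫ h', Real.exp (f h') ∂κ
      ≤ Real.exp (-c) * Real.exp (f h + c) :=
        mul_le_mul_of_nonneg_left hZle (Real.exp_pos _).le
    _ = Real.exp (f h) := by
        rw [← Real.exp_add]
        congr 1
        ring

/-- **Upper bound on the density of a tilted probability measure**: under the same oscillation
hypothesis, `e^{f h} / ∫ e^{f} dκ ≤ e^{c}` (since `e^{f h - c} ≤ ∫ e^{f} dκ`). [folklore] -/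
theorem exp_div_integral_le_exp {κ : Measure K} [IsProbabilityMeasure κ] {f : K → ℝ}
    {c : ℝ} (hfi : Integrable (fun h => Real.exp (f h)) κ) (hosc : ∀ h h', f h' ≤ f h + c)
    (h : K) : Real.exp (f h) / ∫ h', Real.exp (f h') ∂κ ≤ Real.exp c := by
  have hZpos : 0 < ∫ h', Real.exp (f h') ∂κ := integral_exp_pos hfi
  have hZge : Real.exp (f h - c) ≤ ∫ h', Real.exp (f h') ∂κ := by
    have hmono := integral_mono (integrable_const (Real.exp (f h - c))) hfi
      fun h' => Real.exp_le_exp.2 (by linarith [hosc h' h])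
    simpa only [integral_const, probReal_univ, one_smul] using hmono
  rw [div_le_iff₀ hZpos]
  calc Real.exp (f h) = Real.exp c * Real.exp (f h - c) := by
        rw [← Real.exp_add]
        congr 1
        ring
    _ ≤ Real.exp c * ∫ h', Real.exp (f h') ∂κ :=
        mul_le_mul_of_nonneg_left hZge (Real.exp_pos _).le

/-- **Resampling from `κ` is dominated by resampling from the tilted measure**: for a
probability measure `κ`, a measurable tilt `f` with `e^{f}` integrable and oscillation at most
`c`, and a bounded measurable `ψ ≥ 0`, `∫ ψ dκ ≤ e^{c} ∫ ψ d(κ.tilted f)` (the density of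
`κ.tilted f` with respect to `κ` is at least `e^{-c}`, `MeasureTheory.integral_tilted`).
[folklore] -/
theorem integral_le_exp_mul_integral_tilted {κ : Measure K} [IsProbabilityMeasure κ]
    {f : K → ℝ} {c : ℝ} (hf : Measurable f) (hfi : Integrable (fun h => Real.exp (f h)) κ)
    (hosc : ∀ h h', f h' ≤ f h + c) {ψ : K → ℝ} (hψ : Measurable ψ) (hψ0 : ∀ h, 0 ≤ ψ h)
    {B : ℝ} (hψB : ∀ h, ψ h ≤ B) :
    ∫ h, ψ h ∂κ ≤ Real.exp c * ∫ h, ψ h ∂(κ.tilted f) := by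
  rw [integral_tilted]
  have hZpos : 0 < ∫ h', Real.exp (f h') ∂κ := integral_exp_pos hfi
  have hdens : ∀ h, Real.exp (-c) ≤ Real.exp (f h) / ∫ h', Real.exp (f h') ∂κ :=
    exp_neg_le_exp_div_integral hfi hosc
  have hdens' : ∀ h, Real.exp (f h) / ∫ h', Real.exp (f h') ∂κ ≤ Real.exp c :=
    exp_div_integral_le_exp hfi hosc
  have hint : Integrable (fun h => (Real.exp (f h) / ∫ h', Real.exp (f h') ∂κ) • ψ h) κ := by
    refine Integrable.of_bound
      (((Real.measurable_exp.comp hf).div_const _).smul hψ).aestronglyMeasurable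
      (Real.exp c * B) (ae_of_all _ fun h => ?_)
    rw [norm_smul, Real.norm_eq_abs, Real.norm_eq_abs,
      abs_of_nonneg (div_nonneg (Real.exp_pos _).le hZpos.le), abs_of_nonneg (hψ0 h)]
    exact mul_le_mul (hdens' h) (hψB h) (hψ0 h) (Real.exp_pos _).le
  calc ∫ h, ψ h ∂κ = Real.exp c * ∫ h, Real.exp (-c) * ψ h ∂κ := by
        rw [integral_const_mul, ← mul_assoc, ← Real.exp_add, add_neg_cancel, Real.exp_zero,
          one_mul]
    _ ≤ Real.exp c * ∫ h, (Real.exp (f h) / ∫ h', Real.exp (f h') ∂κ) • ψ h ∂κ := by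
        refine mul_le_mul_of_nonneg_left ?_ (Real.exp_pos _).le
        refine integral_mono_of_nonneg (ae_of_all _ fun h => ?_) hint (ae_of_all _ fun h => ?_)
        · exact mul_nonneg (Real.exp_pos _).le (hψ0 h)
        · simp only [smul_eq_mul]
          exact mul_le_mul_of_nonneg_right (hdens h) (hψ0 h)

/-- A tilted probability measure is a probability measure, so it integrates a function bounded
in norm by `B` to something bounded in norm by `B`. [folklore] -/
theorem norm_integral_tilted_le {κ : Measure K} [IsProbabilityMeasure κ] {f : K → ℝ}
    (hfi : Integrable (fun h => Real.exp (f h)) κ) {ψ : K → ℝ} {B : ℝ}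
    (hψB : ∀ h, ‖ψ h‖ ≤ B) : ‖∫ h, ψ h ∂(κ.tilted f)‖ ≤ B := by
  haveI := isProbabilityMeasure_tilted hfi
  have := norm_integral_le_of_norm_le_const (μ := κ.tilted f) (ae_of_all _ hψB)
  simpa only [probReal_univ, mul_one] using this

/-- **Measurability of a parametric tilted integral**: for a jointly measurable tilt `f ω k` and
integrand `ψ ω k` and an s-finite `κ`, `ω ↦ ∫ ψ ω k d(κ.tilted (f ω))(k)` is measurable — by
`integral_tilted` it is the parametric Bochner integral of the jointly measurable
`(ω, k) ↦ (e^{f ω k} / ∫ e^{f ω} dκ) ψ ω k`, the partition function being itself a measurable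
parametric integral. [folklore] -/
theorem measurable_integral_tilted {κ : Measure K} [SFinite κ] {f ψ : Ω → K → ℝ}
    (hf : Measurable fun p : Ω × K => f p.1 p.2) (hψ : Measurable fun p : Ω × K => ψ p.1 p.2) :
    Measurable fun ω => ∫ k, ψ ω k ∂(κ.tilted (f ω)) := by
  have hef : Measurable fun p : Ω × K => Real.exp (f p.1 p.2) := Real.measurable_exp.comp hf
  have hZ : Measurable fun ω => ∫ k, Real.exp (f ω k) ∂κ :=
    (hef.stronglyMeasurable.integral_prod_right' (ν := κ)).measurable
  have hD : Measurable fun p : Ω × K =>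
      (Real.exp (f p.1 p.2) / ∫ k, Real.exp (f p.1 k) ∂κ) * ψ p.1 p.2 :=
    (hef.div (hZ.comp measurable_fst)).mul hψ
  have hI : Measurable fun ω =>
      ∫ k, (Real.exp (f ω k) / ∫ k', Real.exp (f ω k') ∂κ) * ψ ω k ∂κ :=
    (hD.stronglyMeasurable.integral_prod_right' (ν := κ)).measurable
  simp only [integral_tilted, smul_eq_mul]
  exact hI

end Abstract

/-! ### The lattice: one-link oscillation of the Wilson action -/

section Lattice

variable {d L N : ℕ} {G : Type*} [Group G] [NeZero L] (ρ : G →* Matrix (Fin N) (Fin N) ℂ)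

/-- **One-link oscillation of the Wilson action, uniformly in the volume**: two configurations
that differ only on the link `ℓ` have Wilson actions differing by at most
`2 (d+1) · #{planes} · (N + M)`, `M` a bound on `|Re tr ρ|` — the plaquettes based outside the
shadow of `{ℓ}` (at most `d + 1` sites) contribute equally (`bulkAction_congr`), and the shadow
part is bounded by `abs_shadowAction_le`. [folklore] -/
theorem abs_wilsonAction_update_sub_le {M : ℝ} (hM0 : 0 ≤ M) (hM : ∀ g, |(ρ g).trace.re| ≤ M)
    (U : GaugeConfig d L G) (ℓ : Edge d L) (h h' : G) :
    |wilsonAction ρ (Function.update U ℓ h) - wilsonAction ρ (Function.update U ℓ h')| ≤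
      2 * ((((d + 1) * Fintype.card {q : Fin d × Fin d // q.1 < q.2} : ℕ) : ℝ) *
        ((N : ℝ) + M)) := by
  have hagree : ∀ e, e ∉ ({ℓ} : Finset (Edge d L)) →
      Function.update U ℓ h e = Function.update U ℓ h' e := fun e he => by
    rw [Finset.mem_singleton] at he
    rw [Function.update_of_ne he, Function.update_of_ne he]
  rw [wilsonAction_eq_shadowAction_add_bulkAction ρ (edgeShadow ({ℓ} : Finset (Edge d L))),
    wilsonAction_eq_shadowAction_add_bulkAction ρ (edgeShadow ({ℓ} : Finset (Edge d L))),
    bulkAction_congr ρ hagree, add_sub_add_right_eq_sub]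
  have hcard : (edgeShadow ({ℓ} : Finset (Edge d L))).card ≤ d + 1 := by
    simpa only [Finset.card_singleton, one_mul] using
      card_edgeShadow_le ({ℓ} : Finset (Edge d L))
  have hNM : 0 ≤ (N : ℝ) + M := by positivity
  have hsh : ∀ V : GaugeConfig d L G, |shadowAction ρ (edgeShadow ({ℓ} : Finset (Edge d L))) V| ≤
      (((d + 1) * Fintype.card {q : Fin d × Fin d // q.1 < q.2} : ℕ) : ℝ) * ((N : ℝ) + M) :=
    fun V => (abs_shadowAction_le ρ hM _ V).trans
      (mul_le_mul_of_nonneg_right (Nat.cast_le.2 (Nat.mul_le_mul_right _ hcard)) hNM)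
  calc |shadowAction ρ (edgeShadow ({ℓ} : Finset (Edge d L))) (Function.update U ℓ h) -
        shadowAction ρ (edgeShadow ({ℓ} : Finset (Edge d L))) (Function.update U ℓ h')|
      ≤ |shadowAction ρ (edgeShadow ({ℓ} : Finset (Edge d L))) (Function.update U ℓ h)| +
        |shadowAction ρ (edgeShadow ({ℓ} : Finset (Edge d L))) (Function.update U ℓ h')| :=
        abs_sub _ _
    _ ≤ (((d + 1) * Fintype.card {q : Fin d × Fin d // q.1 < q.2} : ℕ) : ℝ) * ((N : ℝ) + M) +
        (((d + 1) * Fintype.card {q : Fin d × Fin d // q.1 < q.2} : ℕ) : ℝ) * ((N : ℝ) + M) :=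
        add_le_add (hsh _) (hsh _)
    _ = _ := by ring

end Lattice

/-! ### The torus: Haar resampling of one link against heat-bath resampling -/

section Torus

variable {G : Type} [Group G] [TopologicalSpace G] [IsTopologicalGroup G] [CompactSpace G]
  [MeasurableSpace G] [BorelSpace G]

/-- **Haar resampling of a link is dominated by heat-bath resampling** (one link, integrated
against the Wilson measure): with `c = |β| · 2 · 5 · #{planes} · (N + M_t)`, `M_t` a bound on
`|Re tr r.ρ|`, for every side `2S+1`, bounded measurable `F` and link `ℓ`,
`∫∫ (F U − F(U[ℓ↦h]))² dHaar(h) dμ(U) ≤ e^{c} ∫∫ (F U − F(U[ℓ↦g]))² dν_ℓ^U(g) dμ(U)` with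
`ν_ℓ^U = Haar.tilted (−β S_W(U[ℓ ↦ ·]))` and `μ = wilsonMeasure r.ρ β`. [folklore] -/
theorem integral_haar_le_exp_mul_integral_heatBath (r : LatticeRep G) (β : ℝ) {Mt : ℝ}
    (hMt0 : 0 ≤ Mt) (hMt : ∀ g, |(r.ρ g).trace.re| ≤ Mt) (S : ℕ)
    {F : GaugeConfig 4 (2 * S + 1) G → ℝ} (hF : Measurable F) {M : ℝ} (hM : ∀ U, |F U| ≤ M)
    (ℓ : Edge 4 (2 * S + 1)) :
    ∫ U, ∫ h, (F U - F (Function.update U ℓ h)) ^ 2 ∂(haarProbability G)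
        ∂(wilsonMeasure r.ρ β : Measure (GaugeConfig 4 (2 * S + 1) G)) ≤
      Real.exp (|β| * (2 * ((((4 + 1) * Fintype.card {q : Fin 4 × Fin 4 // q.1 < q.2} : ℕ) : ℝ) *
        ((r.N : ℝ) + Mt)))) *
      ∫ U, ∫ g, (F U - F (Function.update U ℓ g)) ^ 2
        ∂((haarProbability G).tilted (fun g' => -β * wilsonAction r.ρ (Function.update U ℓ g')))
        ∂(wilsonMeasure r.ρ β : Measure (GaugeConfig 4 (2 * S + 1) G)) := by
  haveI : SecondCountableTopology G :=
    (r.continuous.isClosedEmbedding r.injective).isEmbedding.secondCountableTopology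
  haveI : IsProbabilityMeasure (wilsonMeasure (d := 4) (L := 2 * S + 1) r.ρ β) :=
    isProbabilityMeasure_wilsonMeasure (d := 4) (L := 2 * S + 1) r.ρ r.continuous β
  set c : ℝ := |β| * (2 * ((((4 + 1) * Fintype.card {q : Fin 4 × Fin 4 // q.1 < q.2} : ℕ) : ℝ) *
    ((r.N : ℝ) + Mt))) with hc
  -- joint measurability of the tilt and of the integrand
  have hupd : Measurable fun p : GaugeConfig 4 (2 * S + 1) G × G => Function.update p.1 ℓ p.2 :=
    measurable_update'
  have hfm : Measurable fun p : GaugeConfig 4 (2 * S + 1) G × G =>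
      -β * wilsonAction r.ρ (Function.update p.1 ℓ p.2) :=
    measurable_const.mul ((measurable_wilsonAction r.ρ r.continuous).comp hupd)
  have hψm : Measurable fun p : GaugeConfig 4 (2 * S + 1) G × G =>
      (F p.1 - F (Function.update p.1 ℓ p.2)) ^ 2 :=
    ((hF.comp measurable_fst).sub (hF.comp hupd)).pow_const 2
  -- bounds: the integrand, the oscillation of the tilt, integrability of the Boltzmann factor
  have hψB : ∀ (U : GaugeConfig 4 (2 * S + 1) G) (g : G),
      (F U - F (Function.update U ℓ g)) ^ 2 ≤ (M + M) ^ 2 := fun U g => by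
    have h1 : |F U - F (Function.update U ℓ g)| ≤ M + M :=
      (abs_sub _ _).trans (add_le_add (hM _) (hM _))
    calc (F U - F (Function.update U ℓ g)) ^ 2 = |F U - F (Function.update U ℓ g)| ^ 2 :=
          (sq_abs _).symm
      _ ≤ (M + M) ^ 2 := pow_le_pow_left₀ (abs_nonneg _) h1 2
  have hosc : ∀ (U : GaugeConfig 4 (2 * S + 1) G) (h h' : G),
      -β * wilsonAction r.ρ (Function.update U ℓ h') ≤
        -β * wilsonAction r.ρ (Function.update U ℓ h) + c := fun U h h' => by
    have hd := abs_wilsonAction_update_sub_le r.ρ hMt0 hMt U ℓ h h'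
    have h2 : β * (wilsonAction r.ρ (Function.update U ℓ h) -
        wilsonAction r.ρ (Function.update U ℓ h')) ≤ c :=
      calc _ ≤ |β * (wilsonAction r.ρ (Function.update U ℓ h) -
            wilsonAction r.ρ (Function.update U ℓ h'))| := le_abs_self _
        _ = |β| * |wilsonAction r.ρ (Function.update U ℓ h) -
            wilsonAction r.ρ (Function.update U ℓ h')| := abs_mul _ _
        _ ≤ c := mul_le_mul_of_nonneg_left hd (abs_nonneg β)
    linarith
  obtain ⟨A, hA⟩ := exists_abs_wilsonAction_le (d := 4) (L := 2 * S + 1) (G := G) r.ρ r.continuous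
  have hfi : ∀ U : GaugeConfig 4 (2 * S + 1) G, Integrable
      (fun g : G => Real.exp (-β * wilsonAction r.ρ (Function.update U ℓ g)))
      (haarProbability G) := fun U => by
    refine Integrable.of_bound
      (Real.measurable_exp.comp (hfm.comp (measurable_prodMk_left (x := U)))).aestronglyMeasurable
      (Real.exp (|β| * A)) (ae_of_all _ fun g => ?_)
    rw [Real.norm_eq_abs, Real.abs_exp]
    refine Real.exp_le_exp.2 ?_
    calc -β * wilsonAction r.ρ (Function.update U ℓ g)
        ≤ |-β * wilsonAction r.ρ (Function.update U ℓ g)| := le_abs_self _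
      _ = |β| * |wilsonAction r.ρ (Function.update U ℓ g)| := by rw [abs_mul, abs_neg]
      _ ≤ |β| * A := mul_le_mul_of_nonneg_left (hA _) (abs_nonneg β)
  -- pointwise domination in `U`
  have hpt : ∀ U : GaugeConfig 4 (2 * S + 1) G,
      ∫ h, (F U - F (Function.update U ℓ h)) ^ 2 ∂(haarProbability G) ≤
        Real.exp c * ∫ g, (F U - F (Function.update U ℓ g)) ^ 2
          ∂((haarProbability G).tilted
            (fun g' => -β * wilsonAction r.ρ (Function.update U ℓ g'))) := fun U =>
    integral_le_exp_mul_integral_tilted (hfm.comp (measurable_prodMk_left (x := U))) (hfi U)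
      (hosc U) (hψm.comp (measurable_prodMk_left (x := U))) (fun g => sq_nonneg _) (hψB U)
  -- the heat-bath side is measurable and bounded in `U`, hence integrable
  have hBm : Measurable fun U : GaugeConfig 4 (2 * S + 1) G =>
      ∫ g, (F U - F (Function.update U ℓ g)) ^ 2
        ∂((haarProbability G).tilted (fun g' => -β * wilsonAction r.ρ (Function.update U ℓ g'))) :=
    measurable_integral_tilted hfm hψm
  have hBi : Integrable (fun U : GaugeConfig 4 (2 * S + 1) G => Real.exp c *
      ∫ g, (F U - F (Function.update U ℓ g)) ^ 2
        ∂((haarProbability G).tilted (fun g' => -β * wilsonAction r.ρ (Function.update U ℓ g'))))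
      (wilsonMeasure r.ρ β : Measure (GaugeConfig 4 (2 * S + 1) G)) := by
    refine (Integrable.of_bound hBm.aestronglyMeasurable ((M + M) ^ 2)
      (ae_of_all _ fun U => ?_)).const_mul _
    exact norm_integral_tilted_le (hfi U) fun g => by
      rw [Real.norm_eq_abs, abs_of_nonneg (sq_nonneg _)]
      exact hψB U g
  calc ∫ U, ∫ h, (F U - F (Function.update U ℓ h)) ^ 2 ∂(haarProbability G)
        ∂(wilsonMeasure r.ρ β : Measure (GaugeConfig 4 (2 * S + 1) G))
      ≤ ∫ U, Real.exp c * ∫ g, (F U - F (Function.update U ℓ g)) ^ 2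
          ∂((haarProbability G).tilted (fun g' => -β * wilsonAction r.ρ (Function.update U ℓ g')))
          ∂(wilsonMeasure r.ρ β : Measure (GaugeConfig 4 (2 * S + 1) G)) :=
        integral_mono_of_nonneg (ae_of_all _ fun U => integral_nonneg fun h => sq_nonneg _) hBi
          (ae_of_all _ hpt)
    _ = _ := integral_const_mul _ _

end Torus

end HaarResample

/-! ### The registered stub -/

/-- `stub_haarResample_le_heatBath` — **Haar resampling of a link is dominated by heat-bath
resampling, and double counting** (stub (2c) of the line `orbit-slice-reduction`). There is
`C = C(G, r, β)` (namely `2 e^{c}`, `c = |β| · 2 · 5 · #{planes} · (N + sup |Re tr r.ρ|)`) such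
that for every side `2S+1` and every bounded measurable `F` on the configurations of the 4D torus:
`Σ_x Σ_{ℓ : ℓ.1 = x ∨ ℓ.1.shift ℓ.2 = x} ∫∫ (F U − F(U[ℓ↦h]))² dHaar(h) dμ(U)
  ≤ C Σ_ℓ ∫∫ (F U − F(U[ℓ↦g]))² dν_ℓ^U(g) dμ(U)`,
with `μ = wilsonMeasure r.ρ β` and the one-link heat-bath law
`ν_ℓ^U = Haar.tilted (−β S_W(U[ℓ ↦ ·]))`; every compact `G`, real `β`, every `S`. Each link is
incident to at most two sites (`HaarResample.sum_ite_le_two_mul`), and for each link the Haar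
resampling costs at most `e^{c}` times the heat-bath resampling
(`HaarResample.integral_haar_le_exp_mul_integral_heatBath`). [folklore] -/
theorem stub_haarResample_le_heatBath :
    ∀ (G : Type) [Group G] [TopologicalSpace G] [IsTopologicalGroup G] [CompactSpace G]
      [MeasurableSpace G] [BorelSpace G] (r : LatticeRep G) (β : ℝ), ∃ C : ℝ, ∀ (S : ℕ)
      (F : GaugeConfig 4 (2 * S + 1) G → ℝ), Measurable F → (∃ M : ℝ, ∀ U, |F U| ≤ M) →
      ∑ x : Site 4 (2 * S + 1), ∑ ℓ : Edge 4 (2 * S + 1), (if (ℓ.1 = x ∨ ℓ.1.shift ℓ.2 = x) then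
          ∫ U, ∫ h, (F U - F (Function.update U ℓ h)) ^ 2
            ∂(haarProbability G) ∂(wilsonMeasure r.ρ β : Measure (GaugeConfig 4 (2 * S + 1) G)) else 0) ≤
      C * ∑ ℓ : Edge 4 (2 * S + 1), ∫ U, ∫ g, (F U - F (Function.update U ℓ g)) ^ 2
        ∂((haarProbability G).tilted (fun g' => -β * wilsonAction r.ρ (Function.update U ℓ g')))
        ∂(wilsonMeasure r.ρ β : Measure (GaugeConfig 4 (2 * S + 1) G)) := by
  intro G _ _ _ _ _ _ r β
  obtain ⟨Mt, hMt0, hMt⟩ := exists_bound_trace_re_nonneg r.ρ r.continuous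
  refine ⟨2 * Real.exp (|β| * (2 * ((((4 + 1) * Fintype.card {q : Fin 4 × Fin 4 // q.1 < q.2} : ℕ) :
    ℝ) * ((r.N : ℝ) + Mt)))), fun S F hF hbd => ?_⟩
  obtain ⟨M, hM⟩ := hbd
  rw [Finset.sum_comm, Finset.mul_sum]
  refine Finset.sum_le_sum fun ℓ _ => ?_
  have hH0 : 0 ≤ ∫ U, ∫ h, (F U - F (Function.update U ℓ h)) ^ 2 ∂(haarProbability G)
      ∂(wilsonMeasure r.ρ β : Measure (GaugeConfig 4 (2 * S + 1) G)) :=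
    integral_nonneg fun _ => integral_nonneg fun _ => sq_nonneg _
  have hlink := HaarResample.integral_haar_le_exp_mul_integral_heatBath r β hMt0 hMt S hF hM ℓ
  calc ∑ x : Site 4 (2 * S + 1), (if (ℓ.1 = x ∨ ℓ.1.shift ℓ.2 = x) then
          ∫ U, ∫ h, (F U - F (Function.update U ℓ h)) ^ 2
            ∂(haarProbability G) ∂(wilsonMeasure r.ρ β : Measure (GaugeConfig 4 (2 * S + 1) G))
          else 0)
      ≤ 2 * ∫ U, ∫ h, (F U - F (Function.update U ℓ h)) ^ 2
            ∂(haarProbability G) ∂(wilsonMeasure r.ρ β : Measure (GaugeConfig 4 (2 * S + 1) G)) :=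
        HaarResample.sum_ite_le_two_mul (fun x => ℓ.1 = x ∨ ℓ.1.shift ℓ.2 = x) ℓ.1 (ℓ.1.shift ℓ.2)
          (fun x hx => hx.elim (fun h => Or.inl h.symm) fun h => Or.inr h.symm) hH0
    _ ≤ 2 * (Real.exp (|β| * (2 * ((((4 + 1) * Fintype.card {q : Fin 4 × Fin 4 // q.1 < q.2} : ℕ) :
          ℝ) * ((r.N : ℝ) + Mt)))) *
        ∫ U, ∫ g, (F U - F (Function.update U ℓ g)) ^ 2
          ∂((haarProbability G).tilted (fun g' => -β * wilsonAction r.ρ (Function.update U ℓ g')))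
          ∂(wilsonMeasure r.ρ β : Measure (GaugeConfig 4 (2 * S + 1) G))) :=
        mul_le_mul_of_nonneg_left hlink (by norm_num)
    _ = _ := by ring

end Summit.QuantumFields.YangMills.Theorems.SusceptibilityToPoincare

end
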